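import Literature.MathematicalPhysics.QuantumFieldTheory.Balaban1983to89.B15LeafKnit199
import Literature.MathematicalPhysics.QuantumFieldTheory.Balaban1983to89.Node00.Carriers3

/-!
# `Balaban1983to89.B15LeafKnitStage3` — the N12 knit AT A STAGE-3 WORLD OF RECORD: re-binding any world to the N-binding over NODE 00's
# Stage-3 carriers `carriers₃ θ X` with the B15 bundle PINNED gives a Stage-3 world of record (the pin REFINES Stages 1–3, contradicts nothing)
# at which N01, N02, N04 hold (NODE 00's theorems) AND N12 holds from the B15 leaf of the pinned bundle — the census shape of a Stage-«₇» predicate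

statement-level skeleton of published theorems with citation tags; proofs where landed; nothing here is a claim about
the Yang–Mills mass gap.

TRACK-A KNIT MODULE, companion of `B15LeafKnit`∕`…Exp`∕`…Glue`∕`…199` (HUMAN RULING D-0062; seat `pub-ymgap-dag-n12-a`; `bears_on: R4∕N12`).
PDF held `paper:balaban1989-cmp122-large-field-i` (journal page = PDF page + 174).

WHAT THIS FILE PROVES (theorems only; 0 `sorry`; axioms standard).
* `isWorldOfRecord₃_withUp` — `Node00.WorldP.withUp w₀ (fun _ => ofPrintedAllXPN (carriers₃ θ X) Y Z V W)` is a Stage-3 world of record for admissible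
  `θ` (NODE 00's `isWorldOfRecord₃_of_up`), for EVERY `W` — in particular for the pinned `W := knitW15 κ…`.
* `nodes_N01_N02_N04_N12_withUp_of_leaf` — at that world N01, N02, N04 hold at every run (NODE 00, Stages 1–3) and N12 holds at every run from
  `B15Leaf W`; `nodes_…_withUp_knit` — the same with `W := knitW15 κ` (N12 from `B15LeafKnit.b15Leaf_knit_of`'s displays);
  `nodes_…_withUp_knit_at199_logExp` — with `W := knitW15 κ.at199.logExp` and N12 from the displayed printed estimates Proposition 1 (1.78), (1.80),
  (1.89) + the provisos (`B15LeafKnit199.b15Leaf_knit_at199_logExp_of`).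
* `exists_isWorldOfRecord₃_nodes_N01_N02_N04_N12` — CENSUS (positive side): given admissible Stage-3 parameters and a leaf-carrying `W`, a Stage-3 world
  of record with N01 ∧ N02 ∧ N04 ∧ N12 at every run EXISTS (witness: the re-bound world).  The negative side is NODE 00's ∕ dagwriter's standing fact
  that over the un-pinned Stage-3 frame the paper clusters are jointly refutable (`UVSplitStage3.not_paperClusters_over_stage3Frame`, cell file) — N12
  is proved here ONLY at worlds whose `W` is pinned, never over the free frame (R422).
HONEST FRAMING: bookkeeping by name over `Node00.Carriers3` and `B15LeafKnit199`; count-neutral; NOT a node discharge (the pin of `W` to Bałaban's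
objects is NODE 00's Stage-«₇» definition); one finite four-torus programme at fixed ε; NOT continuum ∕ ℝ⁴ ∕ OS ∕ mass gap ∕ Clay.
-/

noncomputable section

open scoped BigOperators
open MeasureTheory Function

namespace Literature.MathematicalPhysics.QuantumFieldTheory.Balaban1983to89.B15LeafKnitStage3

open DagBinding DagDischargedII
open B15 (Prop1Printed Ineq180)
open B15.BasicStep (fibreIntegral Claim189)
open B15Sect1Statements (Normalization1102)
open B15Claim189Assembly (new189 chiPP dom)
open B8Eq17ClassAkV1 (plaqsOf)
open B15LeafKnit (KnitData knitW15 b15_main_of_up)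
open B15LeafKnit199 (b15Leaf_knit_at199_logExp_of)
open Node00 (Stage3Params carriers₃ IsWorldOfRecord₃ isWorldOfRecord₃_of_up b4_main_of_isWorldOfRecord₃ b5_main_of_isWorldOfRecord₃
  b7_main_of_isWorldOfRecord₃)

/-! ## §1. Re-binding a world to the Stage-3 carriers with a chosen B15 bundle -/

section Generic

variable (θ : Stage3Params) (hθ : θ.toStage1Params.Admissible) (X : PrintedCarriersR) (Y : PrintedCarriers9X) (Z : PrintedCarriers11)
  (V : PrintedCarriers14R) (W : PrintedCarriers15) (w₀ : WorldP)

include hθ in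
/-- Re-binding ANY world to the N-binding over the Stage-3 carriers of record with ANY B15 bundle `W` gives a Stage-3 world of record (NODE 00's
`isWorldOfRecord₃_of_up`; the pin of `W` refines Stages 1–3 and contradicts nothing there). [cite: Balaban1984PropagatorsII, pp.223–250 (objects of record, Stage 3; bookkeeping)] -/
theorem isWorldOfRecord₃_withUp :
    IsWorldOfRecord₃ (Node00.WorldP.withUp w₀ fun _ => Upstream.ofPrintedAllXPN (carriers₃ θ X) Y Z V W) :=
  isWorldOfRecord₃_of_up θ hθ X Y Z V W _ rfl

include hθ in
/-- **N01 ∧ N02 ∧ N04 ∧ N12 at every run of the re-bound Stage-3 world**, N12 from the B15 leaf of the bundle `W` (N01, N02, N04 are NODE 00's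
Stage-1–3 theorems by name). [cite: Balaban1989LargeFieldI, Prop. 1 p.194 (the N12 leaf); Balaban1983RegularityDecay, Theorem p.573; Balaban1984PropagatorsI, Props. 1.1–1.2 pp.33–36; Balaban1985Averaging, Props. 1–10 pp.26–50 (NODE 00's theorems by name)] -/
theorem nodes_N01_N02_N04_N12_withUp_of_leaf (hW : B15Leaf W) (P : B12.RunParams) :
    Dag.B4_main (leavesP (Node00.WorldP.withUp w₀ fun _ => Upstream.ofPrintedAllXPN (carriers₃ θ X) Y Z V W) P) ∧
    Dag.B5_main (leavesP (Node00.WorldP.withUp w₀ fun _ => Upstream.ofPrintedAllXPN (carriers₃ θ X) Y Z V W) P) ∧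
    Dag.B7_main (leavesP (Node00.WorldP.withUp w₀ fun _ => Upstream.ofPrintedAllXPN (carriers₃ θ X) Y Z V W) P) ∧
    Dag.B15_main (leavesP (Node00.WorldP.withUp w₀ fun _ => Upstream.ofPrintedAllXPN (carriers₃ θ X) Y Z V W) P) :=
  have hw := isWorldOfRecord₃_withUp θ hθ X Y Z V W w₀
  ⟨b4_main_of_isWorldOfRecord₃ _ hw P, b5_main_of_isWorldOfRecord₃ _ hw P, b7_main_of_isWorldOfRecord₃ _ hw P,
    b15_main_of_up (w := Node00.WorldP.withUp w₀ fun _ => Upstream.ofPrintedAllXPN (carriers₃ θ X) Y Z V W) (P := P) rfl hW⟩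

include hθ X Y Z V w₀ in
/-- **CENSUS, positive side**: admissible Stage-3 parameters and a leaf-carrying B15 bundle give a Stage-3 world of record with N01 ∧ N02 ∧ N04 ∧ N12 at
every run. [cite: Balaban1989LargeFieldI, Prop. 1 p.194 (bookkeeping witness)] -/
theorem exists_isWorldOfRecord₃_nodes_N01_N02_N04_N12 (hW : B15Leaf W) :
    ∃ w : WorldP, IsWorldOfRecord₃ w ∧ ∀ P : B12.RunParams,
      Dag.B4_main (leavesP w P) ∧ Dag.B5_main (leavesP w P) ∧ Dag.B7_main (leavesP w P) ∧ Dag.B15_main (leavesP w P) :=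
  ⟨_, isWorldOfRecord₃_withUp θ hθ X Y Z V W w₀, nodes_N01_N02_N04_N12_withUp_of_leaf θ hθ X Y Z V W w₀ hW⟩

end Generic

/-! ## §2. The same at the pinned bundle `W := knitW15 κ.at199.logExp`, N12 from the displayed printed estimates -/

section Knit

variable {P : Params} {k : ℕ} {G : Type} [GaugeGroup G] [MeasurableSpace G] [HaarData G] [DecidableEq (PBond P k)]
variable {R : Type} [Fintype R] [DecidableEq R] {P₀ : Params} {C ι : Type}

/-- **N01 ∧ N02 ∧ N04 ∧ N12 at every run of the Stage-3 world re-bound with `W := knitW15 κ`** (the literal record: exponents `κ.Rexp`, density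
`κ.ρk`), N12 from the provisos and the displays (0.5)-on-the-image, Proposition 1 (1.78), (1.80), (1.89), (1.102) (`B15LeafKnit.b15Leaf_knit_of`).
[cite: Balaban1989LargeFieldI, Prop. 1 (1.78) p.194, (0.5) p.176, (1.80) p.195, (1.89) p.198, (1.102) p.201] -/
theorem nodes_N01_N02_N04_N12_withUp_knit (θ : Stage3Params) (hθ : θ.toStage1Params.Admissible) (X : PrintedCarriersR)
    (Y : PrintedCarriers9X) (Zc : PrintedCarriers11) (Vc : PrintedCarriers14R) (w₀ : WorldP) (κ : KnitData P k G R P₀ C ι)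
    (hm : ∀ Z, Measurable (κ.piece Z)) (h0 : ∀ Z V, 0 ≤ κ.piece Z V) {Cρ : ℝ} (hC : ∀ Z V, κ.piece Z V ≤ Cρ)
    (hden : ∀ Z V, fibreIntegral (κ.fib Z) (κ.piece (κ.pp Z)) V ≠ 0)
    (h05 : ∀ W ∈ Finset.univ.image κ.pp, B15Eq06Resum.quotSum κ.rdata W = Real.exp (κ.Rexp W))
    (hP1 : Prop1Printed κ.LF)
    (h180 : ∀ U, new189 κ.D189 U → ∀ j, κ.D189.h ≤ j → j ≤ κ.D189.k → ∀ p ∈ plaqsOf (dom κ.D189 j),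
      Ineq180 (κ.D189.dev0 U p) (κ.D189.ε κ.D189.k) κ.D189.η κ.D189.B₃ κ.D189.B₅ κ.D189.M κ.D189.δ (κ.D189.dist p) κ.D189.O1)
    (h189 : Claim189 (new189 κ.D189) (chiPP κ.D189)) (h1102 : Normalization1102 κ.D1100 κ.ρk) (Pr : B12.RunParams) :
    let w := Node00.WorldP.withUp w₀ fun _ => Upstream.ofPrintedAllXPN (carriers₃ θ X) Y Zc Vc (knitW15 κ)
    IsWorldOfRecord₃ w ∧ Dag.B4_main (leavesP w Pr) ∧ Dag.B5_main (leavesP w Pr) ∧ Dag.B7_main (leavesP w Pr) ∧ Dag.B15_main (leavesP w Pr) :=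
  ⟨isWorldOfRecord₃_withUp θ hθ X Y Zc Vc _ w₀,
    nodes_N01_N02_N04_N12_withUp_of_leaf θ hθ X Y Zc Vc _ w₀ (B15LeafKnit.b15Leaf_knit_of κ hm h0 hC hden h05 hP1 h180 h189 h1102) Pr⟩

/-- **N01 ∧ N02 ∧ N04 ∧ N12 at every run of the Stage-3 world re-bound with `W := knitW15 κ.at199.logExp`**, N12 from the provisos and the displayed
printed estimates Proposition 1 (1.78), (1.80) on the ℍ-domains, (1.89) (`B15LeafKnit199.b15Leaf_knit_at199_logExp_of`).
[cite: Balaban1989LargeFieldI, Prop. 1 (1.78) p.194, (1.80) p.195, (1.89) p.198] -/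
theorem nodes_N01_N02_N04_N12_withUp_knit_at199_logExp (θ : Stage3Params) (hθ : θ.toStage1Params.Admissible) (X : PrintedCarriersR)
    (Y : PrintedCarriers9X) (Zc : PrintedCarriers11) (Vc : PrintedCarriers14R) (w₀ : WorldP) (κ : KnitData P k G R P₀ C ι)
    (hm : ∀ Z, Measurable (κ.piece Z)) (h0 : ∀ Z V, 0 ≤ κ.piece Z V) {Cρ : ℝ} (hC : ∀ Z V, κ.piece Z V ≤ Cρ)
    (hnum : ∀ Z V, fibreIntegral (κ.fib Z) (κ.piece Z) V ≠ 0) (hden : ∀ Z V, fibreIntegral (κ.fib Z) (κ.piece (κ.pp Z)) V ≠ 0)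
    {Cn c Cu : ℝ} (hc : 0 < c)
    (u : (z : κ.D1100.ZK) → (f : κ.D1100.Fam z) → (i : Fin (κ.D1100.fam z f).n) → ((κ.D1100.fam z f).comp i).Loc → Density P k G)
    (B : (z : κ.D1100.ZK) → κ.D1100.TT z → Finset (PBond P k)) (w' : (z : κ.D1100.ZK) → κ.D1100.TT z → Density P k G) {CE Cw : ℝ}
    (hw : ∀ z f i, 0 ≤ ((κ.D1100.fam z f).comp i).weight)
    (hloc : ∀ z f i l, Measurable (((κ.D1100.fam z f).comp i).chiKΛ l) ∧
      (∀ V, 0 ≤ ((κ.D1100.fam z f).comp i).chiKΛ l V ∧ ((κ.D1100.fam z f).comp i).chiKΛ l V ≤ 1) ∧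
      Measurable (((κ.D1100.fam z f).comp i).ins l).num ∧
      (∀ V, 0 ≤ (((κ.D1100.fam z f).comp i).ins l).num V ∧ (((κ.D1100.fam z f).comp i).ins l).num V ≤ Cn) ∧
      (∀ V, c ≤ (((κ.D1100.fam z f).comp i).ins l).den V) ∧ Measurable (u z f i l) ∧
      (∀ V, 0 ≤ u z f i l V ∧ u z f i l V ≤ Cu) ∧
      (∀ ρ, ((κ.D1100.fam z f).comp i).oldOp l ρ
        = fibreIntegral (((κ.D1100.fam z f).comp i).ins l).lam (fun U => u z f i l U * ρ U)) ∧
      (∀ (V : GaugeField P k G) (y : ↥(((κ.D1100.fam z f).comp i).ins l).lam → G),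
        ((κ.D1100.fam z f).comp i).chiKΛ l (updateFinset V (((κ.D1100.fam z f).comp i).ins l).lam y)
          = ((κ.D1100.fam z f).comp i).chiKΛ l V))
    (hlater : ∀ z f (i i' : Fin (κ.D1100.fam z f).n), i < i' → ∀ l l' (V : GaugeField P k G)
      (y : ↥(((κ.D1100.fam z f).comp i').ins l').lam → G),
      ((κ.D1100.fam z f).comp i).chiKΛ l (updateFinset V (((κ.D1100.fam z f).comp i').ins l').lam y)
          = ((κ.D1100.fam z f).comp i).chiKΛ l V ∧
      u z f i l (updateFinset V (((κ.D1100.fam z f).comp i').ins l').lam y) = u z f i l V)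
    (hK4m : ∀ z f, Measurable (κ.D1100.fam z f).chiK4)
    (hK4b : ∀ z f V, 0 ≤ (κ.D1100.fam z f).chiK4 V ∧ (κ.D1100.fam z f).chiK4 V ≤ 1)
    (hK4ind : ∀ z f i l (V : GaugeField P k G) (y : ↥(((κ.D1100.fam z f).comp i).ins l).lam → G),
      (κ.D1100.fam z f).chiK4 (updateFinset V (((κ.D1100.fam z f).comp i).ins l).lam y) = (κ.D1100.fam z f).chiK4 V)
    (hEm : ∀ z, Measurable (κ.D1100.expA z)) (hE0 : ∀ z V, 0 ≤ κ.D1100.expA z V) (hEC : ∀ z V, κ.D1100.expA z V ≤ CE)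
    (httOp : ∀ z t ρ, κ.D1100.ttOp z t ρ = fibreIntegral (B z t) (fun U => w' z t U * ρ U))
    (hwm : ∀ z t, Measurable (w' z t)) (hwb : ∀ z t V, 0 ≤ w' z t V ∧ w' z t V ≤ Cw)
    (hwind : ∀ z t f i l (V : GaugeField P k G) (y : ↥(((κ.D1100.fam z f).comp i).ins l).lam → G),
      w' z t (updateFinset V (((κ.D1100.fam z f).comp i).ins l).lam y) = w' z t V)
    (hP1 : Prop1Printed κ.LF)
    (h180 : ∀ U, new189 κ.D189 U → ∀ j, κ.D189.h ≤ j → j ≤ κ.D189.k → ∀ p ∈ plaqsOf (dom κ.D189 j),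
      Ineq180 (κ.D189.dev0 U p) (κ.D189.ε κ.D189.k) κ.D189.η κ.D189.B₃ κ.D189.B₅ κ.D189.M κ.D189.δ (κ.D189.dist p) κ.D189.O1)
    (h189 : Claim189 (new189 κ.D189) (chiPP κ.D189)) (Pr : B12.RunParams) :
    let w := Node00.WorldP.withUp w₀ fun _ => Upstream.ofPrintedAllXPN (carriers₃ θ X) Y Zc Vc (knitW15 κ.at199.logExp)
    IsWorldOfRecord₃ w ∧ Dag.B4_main (leavesP w Pr) ∧ Dag.B5_main (leavesP w Pr) ∧ Dag.B7_main (leavesP w Pr) ∧ Dag.B15_main (leavesP w Pr) :=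
  ⟨isWorldOfRecord₃_withUp θ hθ X Y Zc Vc _ w₀,
    nodes_N01_N02_N04_N12_withUp_of_leaf θ hθ X Y Zc Vc _ w₀
      (b15Leaf_knit_at199_logExp_of κ hm h0 hC hnum hden hc u B w' hw hloc hlater hK4m hK4b hK4ind hEm hE0 hEC httOp hwm hwb hwind
        hP1 h180 h189) Pr⟩

end Knit

end Literature.MathematicalPhysics.QuantumFieldTheory.Balaban1983to89.B15LeafKnitStage3

end
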